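import Summits.AtomisticToContinuum.BoseEinsteinCondensation.Theses.BECThomsonPrinciple

/-!
# Line `conditional-law-poincare` for crux `FibreConductance` (stmt-AtomisticToContinuum-9480)

Route `BECThomsonPrinciple` (rank-3 crux, shared by no other route); planner skeleton v1
(planner-cruxplan-stmt-AtomisticToContinuum-9480-conditional-law-poin-0, 2026-08-16).

**The crux.** For bounded repulsive finite-range `v`, window parameter `M`, exact zero-free `C¹`
minimisers `Φ` of the periodic `N`-body energy at density `≤ ρ₀`, and every window mode
`k = 2πn/L ≠ 0`, `|k| ≤ M√ρ`: with the bath weight `W(X̂) = ∫_cell |Φ(y,X̂)|²dy`, the conditional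
amplitude `ψ = |Φ|/√W` of particle `0` given the bath `X̂`, `β = ∫ e^{ik·y}ψ` and the fibre-neutral
charge `q = L^{-3/2}(e^{ik·x₀}ψ − βψ²)`, there is a flow `J` in the `x₀`-fibre with weak torus
divergence `q` and Thomson cost `∫ |J|² W/ψ² ≤ C L²/‖n‖²` (`‖n‖` = sup norm).

**Idea (card `conditional-law-poincare`, ideator 3; triage r1: pass ×3, "restate locally").** Per
fibre the cost of the best flow is the dual weighted Sobolev norm `R(X̂) = ‖q‖²_{H⁻¹(μ_X̂)}` of the
charge in the CONDITIONAL LAW `μ_X̂ = ψ(·|X̂)² dy` of particle `0`; Thomson duality + the Poincaré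
inequality of `μ_X̂` give `R(X̂) ≤ C_P(μ_X̂)·(1 − |β|²/L³)` (card's first lemma, re-derived true by all
three triagers). A Poincaré constant is `k`-blind (`C_P ≥ L²/4π²` always), so the GLOBAL form reaches
only the bottom modes. This skeleton is the LOCALISED form the panel asked for: partition the cell
into the `ν³` cubes of side `ℓ = L/ν`, `ν = ‖n‖_∞` (each cube spans exactly one wavelength in the
dominant direction of `k`, so `∫_Q e^{ik·y}dy = 0`, and `ℓ² = L²/‖n‖²` is the crux's budget on the
nose), split the charge into a LOCALLY NEUTRAL part `q_loc` (neutral on every cube) and the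
COARSE-GRAINED BEAT CHARGE `q_c = ψ²·(a_Q/μ_X̂(Q) − L^{-3/2}β)` on `Q`, `a_Q = L^{-3/2}∫_Q e^{ik·y}ψ`,
and route `q_loc` inside each cube by the local (Neumann) Thomson–Poincaré duality. The crux then
follows from three lemmas:

* `stub_localToGlobal` (deterministic weighted potential theory, M–L): local Neumann–Thomson flows
  on the cubes (Lax–Milgram in `H¹(Q, ψ²dy)`, coercive by the local Poincaré constant) glued with
  any coarse flow: `cost ≤ 2·(local Poincaré moment) + 2·cost(J_c)`; free of `(H1)`.
* `stub_localPoincareMoment` (THE LEVER; L): for exact zero-free minimisers at small density, the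
  bath-averaged, cube-averaged local Poincaré constant of the conditional law at the wavelength
  scale is `O(ℓ²)`: `E_W[ν⁻³ Σ_Q Λ_Q w_Q] ≤ A ℓ²` (`w_Q = ∫_Q |q_loc|²/ψ² ≤ 4ℓ³/L³`
  deterministically, so this is `E_W[avg_Q Λ_Q(X̂)] ≲ ℓ²`) — the cage half of the crux, ALL of it at
  `‖n‖_∞ = 1`; uses `(H1)` (fails for the disprover's slab cage).
* `stub_coarseBeatFlow` (HARDEST; XL, BEC-adjacent at the window top): the coarse beat charge `q_c`
  has a fibre flow of cost `≤ B ℓ²`. Identically ZERO charge at `‖n‖_∞ = 1` (one cube: `a = L^{-3/2}β`,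
  `μ = 1`), `= 0` at `v = 0` for every `n` (`a_Q = 0` on wavelength-commensurate cubes, `β = 0`);
  in the thermodynamic limit at the window top it carries the crux's entire infrared content
  (InfraredNecessity, Disproof §D, applies to it verbatim: it forces single-mode occupation bounds
  next to `−k`) — flagged to the lead / tenure planner (re-cut advice `FibreConductanceUnderIR`).

`FibreConductance_of : Sig.stub_localToGlobal → Sig.stub_localPoincareMoment →
Sig.stub_coarseBeatFlow → FibreConductance` is sorry-free (pure logic: `ρ₀ = min`, `N₀ = max`,
`C = 2A + 2B`), and `fibreConductance_skeleton : FibreConductance` applies it to the three sorried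
stubs (so the file is literally a proof of the crux modulo the registered stubs). Each stub's
statement is the `Prop` `Sig.stub_<name>` (its signature) and the registered obligation is
`theorem stub_<name> : Sig.stub_<name> := by sorry` (layer-invariant audit: hypothesis heads = stub
names; `@[stub]` tags are gate-stamped, not written here — until then the advisory file audit shows
the `Sig` defs as `vendored-fact` and `FibreConductance_of` as `proof.conditional`, as for every
Lines file of this convention). `fibreConductance_iff` (by `Iff.rfl`) pins the vocabulary of this
file to the crux DEFINITIONALLY. All other definitions are data (`ℝ`/`ℂ`/`ℝ≥0∞`/`Set`-valued); the
two predicates of the line (fibre flow, local Poincaré constant) are INLINED in the signatures.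

**Disproof.lean v5 (refuter-cdisprove, 2026-08-15T23:09Z; read through its evidence notes — the
evidence tree is not mounted in planner jails) — obligations honoured.**
`not_fibreConductanceWithoutMinimiser` (`(H1)` exact minimiser is load-bearing; slab-cage product
state `Π(ε + sin²(2πx_{i,0}/L))`): `(H1)` is a hypothesis of `stub_localPoincareMoment` and
`stub_coarseBeatFlow` and is USED in the former — for the slab state at `n = e₁` the conditional law
is the double well `(ε + sin²)²dy₀`, whose Poincaré constant diverges as `ε → 0` while `β = 0`,
`w = 1`, and `stub_coarseBeatFlow` is vacuous there (`q_c ≡ 0`), so the skeleton fails exactly where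
the disproof says it must. `not_fibreConductanceSharp` (`C ≥ 1/4π²`): the line's constant at `v = 0`
is `2/π² > 1/4π²` (Neumann Poincaré constant `(ℓ/π)²` of a cube), never below the floor.
`fibreConductance_at_zero` / `exists_const_of_periodicEnergy_zero` (free instance): both
quantitative stubs hold at `v = 0` with `A = 1/π²`, any `B > 0` (sanity check of every
normalisation: `locMoment = (ν/L)³·(ℓ²/π²)·(ℓ³/L³)·L³ = ℓ²/π²`). `hardCore_no_admissible_state`:
bounded `v` throughout, nothing to do. `pairing_le_of_isFibreFlow` (§D duality): the tool behind
InfraredNecessity, which is why `stub_coarseBeatFlow` is ranked hardest. No Negative lemma has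
landed under `Theorems/FibreConductance/` (checked 2026-08-16); `ledger negatives` (12) unrelated.
-/

noncomputable section

open MeasureTheory
open scoped ENNReal

namespace Summit.AtomisticToContinuum.BoseEinsteinCondensation.Cruxes.FibreConductance.ConditionalLawPoincare

open Literature.MathematicalPhysics.QuantumManyBody.BoseGas
open Summit.AtomisticToContinuum.BoseEinsteinCondensation.Theses.BECThomsonPrinciple

/-! ## Vocabulary of the crux (definitionally the crux's `let`s; see `fibreConductance_iff`) -/

/-- Bath weight `W(X̂) = ∫_cell |Φ(y, X̂)|² dy` (a function of `X` through the bath `X̂` only). -/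
def fibreW {m : ℕ} (L : ℝ) (Φ : Config (m + 1) → ℂ) (X : Config (m + 1)) : ℝ :=
  ∫ y in cell L, ‖Φ (Function.update X 0 y)‖ ^ 2

/-- Conditional amplitude `ψ(y | X̂) = |Φ(y, X̂)| / √W(X̂)` of particle `0` given the bath
(`∫_cell ψ(·|X̂)² = 1`: the density of the CONDITIONAL LAW `μ_X̂` of the line's name). -/
def fibrePsi {m : ℕ} (L : ℝ) (Φ : Config (m + 1) → ℂ) (X : Config (m + 1)) : ℝ :=
  ‖Φ X‖ / Real.sqrt (fibreW L Φ X)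

/-- The plane wave `e^{ik·y}`, `k = 2πn/L`. -/
def wave (L : ℝ) (n : Fin 3 → ℤ) (y : Space) : ℂ :=
  Complex.exp (Complex.I * ↑(2 * Real.pi / L * ∑ j, (n j : ℝ) * y j))

/-- `β(X̂) = ∫_cell e^{ik·y} ψ(y | X̂) dy`. -/
def fibreBeta {m : ℕ} (L : ℝ) (n : Fin 3 → ℤ) (Φ : Config (m + 1) → ℂ) (X : Config (m + 1)) : ℂ :=
  ∫ y in cell L, wave L n y * (fibrePsi L Φ (Function.update X 0 y) : ℂ)

/-- The fibre-neutral charge `q = L^{-3/2} (e^{ik·x₀} ψ − β ψ²)`. -/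
def fibreCharge {m : ℕ} (L : ℝ) (n : Fin 3 → ℤ) (Φ : Config (m + 1) → ℂ) (X : Config (m + 1)) : ℂ :=
  ((Real.sqrt (L ^ 3))⁻¹ : ℂ) *
    (wave L n (X 0) * (fibrePsi L Φ X : ℂ) - fibreBeta L n Φ X * (fibrePsi L Φ X : ℂ) ^ 2)

/-- The pairing `∫_{cell^N} J · ∇₀η` of a fibre field with the `x₀`-gradient of a test function. -/
def flowPairing (m : ℕ) (L : ℝ) (J : Config (m + 1) → (Fin 3 → ℂ)) (η : Config (m + 1) → ℂ) : ℂ :=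
  ∫ X in cellN (m + 1) L, ∑ l : Fin 3, J X l * fderiv ℝ η X (Pi.single 0 (EuclideanSpace.single l (1 : ℝ)))

/-- The pairing `∫_{cell^N} q η` of a charge with a test function. -/
def chargePairing (m : ℕ) (L : ℝ) (q : Config (m + 1) → ℂ) (η : Config (m + 1) → ℂ) : ℂ :=
  ∫ X in cellN (m + 1) L, q X * η X

/-- Thomson cost `∫_{cell^N} |J|² W/ψ²` of a fibre field. -/
def fibreCost {m : ℕ} (L : ℝ) (Φ : Config (m + 1) → ℂ) (J : Config (m + 1) → (Fin 3 → ℂ)) : ℝ≥0∞ :=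
  ∫⁻ X in cellN (m + 1) L,
    ENNReal.ofReal ((∑ l : Fin 3, ‖J X l‖ ^ 2) * fibreW L Φ X / fibrePsi L Φ X ^ 2)

/-- The crux restated with the vocabulary above — DEFINITIONALLY (`Iff.rfl`): a fibre flow is a
field `J` with `flowPairing J η = −chargePairing q η` for every `C¹` fully periodic `η`. -/
theorem fibreConductance_iff :
    FibreConductance ↔
    ∀ v : ℝ → ℝ≥0∞, IsRepulsiveFiniteRange v → (∃ B : ℝ, ∀ r, v r ≤ ENNReal.ofReal B) →
      ∀ M : ℝ, 0 < M → ∃ ρ₀ C : ℝ, 0 < ρ₀ ∧ 0 < C ∧ ∃ N₀ : ℕ, ∀ m : ℕ, N₀ ≤ m + 1 →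
        ∀ L : ℝ, 0 < L → ((m + 1 : ℕ) : ℝ) ≤ ρ₀ * L ^ 3 → ∀ n : Fin 3 → ℤ, n ≠ 0 →
          2 * Real.pi * ‖(fun j => (n j : ℝ))‖ / L ≤ M * Real.sqrt ((m + 1 : ℕ) / L ^ 3) →
            ∀ Φ : PeriodicTrialState (m + 1) L,
              periodicEnergy v Φ = periodicGroundStateEnergy v (m + 1) L → (∀ X, Φ.ψ X ≠ 0) →
                ∃ J : Config (m + 1) → (Fin 3 → ℂ),
                  (∀ η : Config (m + 1) → ℂ, ContDiff ℝ 1 η →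
                    (∀ X (i : Fin (m + 1)) (l : Fin 3),
                        η (X + Pi.single i (EuclideanSpace.single l L)) = η X) →
                      flowPairing m L J η = - chargePairing m L (fibreCharge L n Φ.ψ) η) ∧
                  fibreCost L Φ.ψ J ≤ ENNReal.ofReal (C * L ^ 2 / ‖(fun j => (n j : ℝ))‖ ^ 2) :=
  Iff.rfl

/-! ## The wavelength-scale partition and the local / coarse split of the charge -/

/-- `ν(n) = max_j |n_j| ∈ ℕ` — the sup norm `‖n‖_∞` the crux uses, as a natural number (`≥ 1` for
`n ≠ 0`); the cell is tiled by `ν³` cubes of side `ℓ = L/ν`, and `∫_Q e^{ik·y} dy = 0` on each of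
them (the dominant coordinate spans exactly one period). -/
def supIdx (n : Fin 3 → ℤ) : ℕ :=
  Finset.univ.sup fun j => (n j).natAbs

/-- Integer label of the partition cube of side `L/ν` containing `y`. -/
def cubeIdx (L : ℝ) (ν : ℕ) (y : Space) : Fin 3 → ℤ :=
  fun j => ⌊y j * (ν : ℝ) / L⌋

/-- The partition cube `Q(y) ⊆ cell` (half-open, side `L/ν`) containing `y`. -/
def cube (L : ℝ) (ν : ℕ) (y : Space) : Set Space :=
  {z | z ∈ cell L ∧ cubeIdx L ν z = cubeIdx L ν y}

/-- Local mass `μ_X̂(Q(x₀)) = ∫_{Q(x₀)} ψ(z|X̂)² dz` of the conditional law. -/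
def locMass {m : ℕ} (L : ℝ) (ν : ℕ) (Φ : Config (m + 1) → ℂ) (X : Config (m + 1)) : ℝ :=
  ∫ z in cube L ν (X 0), fibrePsi L Φ (Function.update X 0 z) ^ 2

/-- Local beat coefficient `a_{Q(x₀)}(X̂) = L^{-3/2} ∫_{Q(x₀)} e^{ik·z} ψ(z|X̂) dz`
(`= L^{-3/2}∫_Q e^{ik·z}(ψ − c)dz` for any constant `c`: it measures the oscillation of the
conditional amplitude at the wavelength scale). -/
def locBeat {m : ℕ} (L : ℝ) (ν : ℕ) (n : Fin 3 → ℤ) (Φ : Config (m + 1) → ℂ) (X : Config (m + 1)) : ℂ :=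
  ((Real.sqrt (L ^ 3))⁻¹ : ℂ) * ∫ z in cube L ν (X 0), wave L n z * (fibrePsi L Φ (Function.update X 0 z) : ℂ)

/-- The COARSE-GRAINED BEAT CHARGE `q_c = ψ² · (a_Q/μ_X̂(Q) − L^{-3/2} β)` on the cube `Q ∋ x₀`:
`μ_X̂`-proportional inside each cube, total charge `a_Q − μ_X̂(Q)·L^{-3/2}β` on `Q`, fibre-neutral
(`Σ_Q a_Q = L^{-3/2}β`, `Σ_Q μ_X̂(Q) = 1`). Vanishes identically when `ν = 1`. -/
def coarseCharge {m : ℕ} (L : ℝ) (ν : ℕ) (n : Fin 3 → ℤ) (Φ : Config (m + 1) → ℂ)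
    (X : Config (m + 1)) : ℂ :=
  (fibrePsi L Φ X : ℂ) ^ 2 *
    (locBeat L ν n Φ X / (locMass L ν Φ X : ℂ) - ((Real.sqrt (L ^ 3))⁻¹ : ℂ) * fibreBeta L n Φ X)

/-- The LOCALLY NEUTRAL charge `q_loc = q − q_c = L^{-3/2}e^{ik·x₀}ψ − ψ² a_Q/μ_X̂(Q)`
(`∫_Q q_loc dz = a_Q − a_Q = 0` on every cube). -/
def localCharge {m : ℕ} (L : ℝ) (ν : ℕ) (n : Fin 3 → ℤ) (Φ : Config (m + 1) → ℂ)
    (X : Config (m + 1)) : ℂ :=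
  fibreCharge L n Φ X - coarseCharge L ν n Φ X

/-- Local charge weight `w_{Q(x₀)}(X̂) = ∫_{Q(x₀)} |q_loc|²/ψ² dz` (`≤ 4ℓ³/L³` always, by
Cauchy–Schwarz on `a_Q`). -/
def locWeight {m : ℕ} (L : ℝ) (ν : ℕ) (n : Fin 3 → ℤ) (Φ : Config (m + 1) → ℂ) (X : Config (m + 1)) : ℝ :=
  ∫ z in cube L ν (X 0),
    ‖localCharge L ν n Φ (Function.update X 0 z)‖ ^ 2 / fibrePsi L Φ (Function.update X 0 z) ^ 2

/-- Local `μ_X̂`-average of a test function over the cube of `x₀`. -/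
def locAvg {m : ℕ} (L : ℝ) (ν : ℕ) (Φ : Config (m + 1) → ℂ) (X : Config (m + 1)) (f : Space → ℂ) : ℂ :=
  (∫ z in cube L ν (X 0), f z * ((fibrePsi L Φ (Function.update X 0 z) : ℂ) ^ 2)) /
    (locMass L ν Φ X : ℂ)

/-- Local `μ_X̂`-variance `∫_{Q(x₀)} |f − ⟨f⟩_{μ,Q}|² ψ² dz` of a test function. -/
def locVar {m : ℕ} (L : ℝ) (ν : ℕ) (Φ : Config (m + 1) → ℂ) (X : Config (m + 1)) (f : Space → ℂ) : ℝ :=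
  ∫ z in cube L ν (X 0), ‖f z - locAvg L ν Φ X f‖ ^ 2 * fibrePsi L Φ (Function.update X 0 z) ^ 2

/-- Local weighted Dirichlet energy `∫_{Q(x₀)} Σ_l |∂_l f|² ψ² dz` of a test function. -/
def locDirichlet {m : ℕ} (L : ℝ) (ν : ℕ) (Φ : Config (m + 1) → ℂ) (X : Config (m + 1))
    (f : Space → ℂ) : ℝ :=
  ∫ z in cube L ν (X 0),
    (∑ l : Fin 3, ‖fderiv ℝ f z (EuclideanSpace.single l (1 : ℝ))‖ ^ 2) *
      fibrePsi L Φ (Function.update X 0 z) ^ 2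

/-- The LOCAL POINCARÉ MOMENT `(ν/L)³ ∫_{cell^N} W(X̂) Λ(X) w_{Q(x₀)}(X̂) dX = E_W[Σ_Q Λ̄_Q w_Q]`
(`Λ̄_Q` = average of `Λ(·, X̂)` over `Q`) of a field of local Poincaré constants `Λ`. -/
def locMoment {m : ℕ} (L : ℝ) (ν : ℕ) (n : Fin 3 → ℤ) (Φ : Config (m + 1) → ℂ)
    (Λ : Config (m + 1) → ℝ) : ℝ≥0∞ :=
  ENNReal.ofReal (((ν : ℝ) / L) ^ 3) *
    ∫⁻ X in cellN (m + 1) L, ENNReal.ofReal (fibreW L Φ X * Λ X * locWeight L ν n Φ X)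

/-! ## The stubs

Each stub's statement is the `Prop` `Sig.stub_<name>`; the registered obligation is
`theorem stub_<name> : Sig.stub_<name> := by sorry`; `FibreConductance_of` takes the three
signatures as hypotheses BY NAME. -/

/-- **Stub 1 — local-to-global Thomson gluing (deterministic; size M–L; no `(H1)`).** For ANY
zero-free `C¹` periodic normalised `Φ`, any `n ≠ 0`, any measurable field `Λ ≥ 0` of local
Poincaré constants of the conditional laws on the wavelength cubes (`locVar ≤ Λ · locDirichlet` for
all `C¹` test functions — the Neumann class of the cube), and any a.e.-measurable fibre flow `J_c` of
the coarse beat charge: a fibre flow of the full charge `q` exists with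
`cost ≤ 2·locMoment(Λ) + 2·cost(J_c)`. Why true: on each cube `Q` of each fibre `X̂` solve the
Neumann problem `div(ψ²∇u) = q_loc` weakly in `H¹(Q, ψ²dz)` (Lax–Milgram; compatibility = local
neutrality of `q_loc`; coercivity on mean-zero functions = the local Poincaré inequality, which
extends from `C¹` to `H¹(Q)` because `ψ` is continuous and bounded below on the compact cell);
`J_loc := −ψ²∇u` glued over the cubes pairs correctly with every global `C¹` test function (natural
boundary condition, no boundary terms), `∫_Q |J_loc|²/ψ² = ∫_Q q_loc ū ≤ (w_Q Λ ∫_Q ψ²|∇u|²)^{1/2}`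
for EVERY admissible constant `Λ = Λ(y, X̂)`, `y ∈ Q`, hence `≤ Λ̄_Q w_Q`; integrate `W(X̂)dX̂`
(Tonelli; measurable dependence of the Lax–Milgram solution on the data), add `J_c`,
`|a + b|² ≤ 2|a|² + 2|b|²`. Mathlib has Lax–Milgram (`IsCoercive.continuousLinearEquivOfBilin`) but
no weighted `H¹` of a box: the formalisation is the bulk of the size. [folklore; LyonsPeres2016 Ch. 2
(Thomson's principle); doi:10.1063/1.1734192 (Prager–Hirschfelder: the one-body dielectric picture)] -/
def Sig.stub_localToGlobal : Prop :=
  ∀ (m : ℕ) (L : ℝ), 0 < L → ∀ n : Fin 3 → ℤ, n ≠ 0 →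
    ∀ Φ : PeriodicTrialState (m + 1) L, (∀ X, Φ.ψ X ≠ 0) →
      ∀ Λ : Config (m + 1) → ℝ, Measurable Λ → (∀ X, 0 ≤ Λ X) →
        (∀ (X : Config (m + 1)) (f : Space → ℂ), ContDiff ℝ 1 f →
          locVar L (supIdx n) Φ.ψ X f ≤ Λ X * locDirichlet L (supIdx n) Φ.ψ X f) →
        ∀ Jc : Config (m + 1) → (Fin 3 → ℂ),
          AEStronglyMeasurable Jc (volume.restrict (cellN (m + 1) L)) →
          (∀ η : Config (m + 1) → ℂ, ContDiff ℝ 1 η →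
            (∀ X (i : Fin (m + 1)) (l : Fin 3), η (X + Pi.single i (EuclideanSpace.single l L)) = η X) →
              flowPairing m L Jc η = - chargePairing m L (coarseCharge L (supIdx n) n Φ.ψ) η) →
          ∀ A B : ℝ, 0 ≤ A → 0 ≤ B →
            locMoment L (supIdx n) n Φ.ψ Λ ≤ ENNReal.ofReal (A * L ^ 2 / ‖(fun j => (n j : ℝ))‖ ^ 2) →
            fibreCost L Φ.ψ Jc ≤ ENNReal.ofReal (B * L ^ 2 / ‖(fun j => (n j : ℝ))‖ ^ 2) →
              ∃ J : Config (m + 1) → (Fin 3 → ℂ),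
                (∀ η : Config (m + 1) → ℂ, ContDiff ℝ 1 η →
                  (∀ X (i : Fin (m + 1)) (l : Fin 3),
                      η (X + Pi.single i (EuclideanSpace.single l L)) = η X) →
                    flowPairing m L J η = - chargePairing m L (fibreCharge L n Φ.ψ) η) ∧
                fibreCost L Φ.ψ J ≤
                  ENNReal.ofReal ((2 * A + 2 * B) * L ^ 2 / ‖(fun j => (n j : ℝ))‖ ^ 2)

/-- **Stub 2 — local Poincaré moment of the conditional law (THE LEVER; size L; uses `(H1)`).** For
bounded repulsive finite-range `v` and exact zero-free minimisers in the crux's regime there is a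
measurable field `Λ ≥ 0` of local Poincaré constants of the conditional laws `μ_X̂ = ψ(·|X̂)²dz` on the
wavelength cubes with `locMoment(Λ) ≤ A L²/‖n‖²`; since `w_Q ≤ 4ℓ³/L³` deterministically this says
`E_W[ν⁻³ Σ_Q Λ_Q(X̂)] ≤ (A/4)·ℓ²`: the bath-averaged, cube-averaged Poincaré constant of the
conditional law at scale `ℓ = L/‖n‖_∞ ≥ 2π/(M√ρ)` (many particles per cube) is `O(ℓ²)`. Free gas:
`Λ ≡ (ℓ/π)²` (Neumann Poincaré constant of a cube), `locMoment = ℓ²/π²`, `A = 1/π²`. Why plausibly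
true: `Λ_Q ≤ (ℓ/π)²·s_Q²` with `s_Q = sup_Q ψ / inf_Q ψ`; interior dips at bath particles are
harmless for a Poincaré constant up to the two-sided oscillation of `ψ` on the bath-free part of `Q`
and local-to-global / bad-cube renormalisation (Fabes–Kenig–Serapioni `A₂` weights, Barlow 2004,
Mathieu–Remy 2004); only CLOSED SHELLS of bath particles inside `Q` (cages) inflate `Λ_Q`, by
`e^{c·(layers)}`, against a shell probability `(CρR³)^{layers}` under the Born law. Inputs NOT in
print (shared with every cage card of this crux, per triage): N-uniform two-sided control of
`y ↦ Ψ₀(y, X̂)` on bath-free regions and local-number (Ruelle-type) tails of `|Ψ₀|²` — natural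
suppliers: crux ideas `marginal-subsolution-shells` (K-body subsolution inequality, true) and
`tagged-path-harnack-cage-moments` (repaired fixed-horizon form). Why it might fail: a
thermodynamic-limit lower bound on the conditional amplitude inside rare cages is a one-variable
Harnack statement for `Ψ₀` with `‖V‖∞ ~ N`; at the bottom modes (`ℓ ~ L`) the statement also
needs BOUNDED large-scale log-fluctuations of `ψ(·|X̂)` (a Jastrow amplitude with `a/r` tails
over a Poissonian bath has `Var[log ψ(y) − log ψ(y')] ≍ ρa²|y − y'|`, unbounded at `|y−y'| ~ L`;
the hyperuniform ground state with Reatto–Chester `1/r²` tails has bounded variance — a proof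
must extract this from `(H1)`); FALSE without `(H1)` (slab cage:
`not_fibreConductanceWithoutMinimiser`). [folklore (weighted Poincaré / local-to-global);
GrimmettKestenZhang1993 = doi:10.1007/bf01195881; doi:10.1214/009117904000000748 (Barlow);
doi:10.1214/aop/1078415830 (Mathieu–Remy); doi:10.1080/03605308208820218 (Fabes–Kenig–Serapioni);
doi:10.1007/bf01011161 (Holley–Stroock); doi:10.1007/bf00252910 (Payne–Weinberger); ReattoChester1967] -/
def Sig.stub_localPoincareMoment : Prop :=
  ∀ v : ℝ → ℝ≥0∞, IsRepulsiveFiniteRange v → (∃ B : ℝ, ∀ r, v r ≤ ENNReal.ofReal B) →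
    ∀ M : ℝ, 0 < M → ∃ ρ₀ A : ℝ, 0 < ρ₀ ∧ 0 < A ∧ ∃ N₀ : ℕ, ∀ m : ℕ, N₀ ≤ m + 1 →
      ∀ L : ℝ, 0 < L → ((m + 1 : ℕ) : ℝ) ≤ ρ₀ * L ^ 3 → ∀ n : Fin 3 → ℤ, n ≠ 0 →
        2 * Real.pi * ‖(fun j => (n j : ℝ))‖ / L ≤ M * Real.sqrt ((m + 1 : ℕ) / L ^ 3) →
          ∀ Φ : PeriodicTrialState (m + 1) L,
            periodicEnergy v Φ = periodicGroundStateEnergy v (m + 1) L → (∀ X, Φ.ψ X ≠ 0) →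
              ∃ Λ : Config (m + 1) → ℝ, Measurable Λ ∧ (∀ X, 0 ≤ Λ X) ∧
                (∀ (X : Config (m + 1)) (f : Space → ℂ), ContDiff ℝ 1 f →
                  locVar L (supIdx n) Φ.ψ X f ≤ Λ X * locDirichlet L (supIdx n) Φ.ψ X f) ∧
                locMoment L (supIdx n) n Φ.ψ Λ ≤
                  ENNReal.ofReal (A * L ^ 2 / ‖(fun j => (n j : ℝ))‖ ^ 2)

/-- **Stub 3 — the coarse beat charge has a cheap flow (HARDEST; size XL; uses `(H1)`).** For exact
zero-free minimisers in the crux's regime the coarse-grained beat charge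
`q_c = ψ²(a_Q/μ_X̂(Q) − L^{-3/2}β)` admits an a.e.-measurable fibre flow `J_c` with
`cost(J_c) ≤ B L²/‖n‖²`. Degenerate checks: `‖n‖_∞ = 1` ⇒ one cube, `a = L^{-3/2}β`, `μ = 1`,
`q_c ≡ 0`, `J_c = 0` (the bottom modes are ENTIRELY Stubs 1+2 — the card's original claim);
`v = 0` ⇒ `ψ` constant, `a_Q = L⁻³∫_Q e^{ik·z}dz = 0` (commensurate cubes), `β = 0`, `q_c ≡ 0`.
Content: `q_c` is `μ_X̂`-proportional on each cube, so at wavelengths `≫ ℓ` it IS `q`, and the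
duality tool (Disproof §D, ideator-2's InfraredNecessity) bounds `cost(J_c)` BELOW by
`L⁻³ E_W|ψ̂(P−k) − β(ψ²)^(P)|²/P²` for `|P| ≪ 1/ℓ`: the stub carries the crux's thermodynamic-limit
single-mode occupation content next to `−k` (vacuous for `ρaL² ≲ 1` and `|n| = O(1)`; BEC-adjacent at
the window top `|k| = M√ρ`). Suggested attack (line card): coarse-grain to a LATTICE Thomson
problem on the `ν³` torus grid — edge resistances `Λ_{Q∪Q'}(1/μ(Q) + 1/μ(Q'))` from double-cube
Poincaré constants (Stub 2's lever one scale up), charges `a_Q − μ(Q)Σa` — whose flat energy is the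
beat sum `Σ_{|P|≲1/ℓ} |â(P)|²/P²`, controlled by `(ℓ²/θπ²)∫|∇ψ|²dz` per fibre (Poincaré on cubes for
`a_Q`, cube-mass non-degeneracy `μ(Q) ≥ θℓ³/L³`) and `E_W∫|∇₀ψ|² ≤ T/N ≤ 4πρa(1+o(1))` (fibre Fisher
information ≤ kinetic energy per particle, Dyson's bound `LSSY2005_upperBound_periodic_holds`, PROVED)
— this closes `ρaL² ≲ 1`; beyond, an occupation input of KLS shape is needed (joint closure with the
route's rank 2 / the re-cut `FibreConductanceUnderIR`). Why it might fail: it is false for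
non-minimisers and its thermodynamic-limit content is an `O(L)` single-mode occupation bound for
exact ground states that no energy method gives. [LSSY2005 Thm 2.2; LyonsPeres2016 Ch. 2;
GrimmettKestenZhang1993] -/
def Sig.stub_coarseBeatFlow : Prop :=
  ∀ v : ℝ → ℝ≥0∞, IsRepulsiveFiniteRange v → (∃ B : ℝ, ∀ r, v r ≤ ENNReal.ofReal B) →
    ∀ M : ℝ, 0 < M → ∃ ρ₀ B : ℝ, 0 < ρ₀ ∧ 0 < B ∧ ∃ N₀ : ℕ, ∀ m : ℕ, N₀ ≤ m + 1 →
      ∀ L : ℝ, 0 < L → ((m + 1 : ℕ) : ℝ) ≤ ρ₀ * L ^ 3 → ∀ n : Fin 3 → ℤ, n ≠ 0 →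
        2 * Real.pi * ‖(fun j => (n j : ℝ))‖ / L ≤ M * Real.sqrt ((m + 1 : ℕ) / L ^ 3) →
          ∀ Φ : PeriodicTrialState (m + 1) L,
            periodicEnergy v Φ = periodicGroundStateEnergy v (m + 1) L → (∀ X, Φ.ψ X ≠ 0) →
              ∃ Jc : Config (m + 1) → (Fin 3 → ℂ),
                AEStronglyMeasurable Jc (volume.restrict (cellN (m + 1) L)) ∧
                (∀ η : Config (m + 1) → ℂ, ContDiff ℝ 1 η →
                  (∀ X (i : Fin (m + 1)) (l : Fin 3),
                      η (X + Pi.single i (EuclideanSpace.single l L)) = η X) →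
                    flowPairing m L Jc η = - chargePairing m L (coarseCharge L (supIdx n) n Φ.ψ) η) ∧
                fibreCost L Φ.ψ Jc ≤ ENNReal.ofReal (B * L ^ 2 / ‖(fun j => (n j : ℝ))‖ ^ 2)

/-- Registered stub 1 (deterministic local-to-global Thomson gluing). -/
theorem stub_localToGlobal : Sig.stub_localToGlobal := by
  sorry

/-- Registered stub 2 (local Poincaré moment of the conditional law — the lever). -/
theorem stub_localPoincareMoment : Sig.stub_localPoincareMoment := by
  sorry

/-- Registered stub 3 (coarse beat charge — hardest). -/
theorem stub_coarseBeatFlow : Sig.stub_coarseBeatFlow := by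
  sorry

/-! ## Composition (sorry-free) -/

/-- **The line concludes the crux BY NAME.** `ρ₀ = min`, `N₀ = max`, `C = 2A + 2B`; Stub 1 glues
the local Poincaré flows of Stub 2 with the coarse flow of Stub 3. -/
theorem FibreConductance_of :
    Sig.stub_localToGlobal → Sig.stub_localPoincareMoment → Sig.stub_coarseBeatFlow →
      FibreConductance := by
  intro hLG hPM hCB
  refine fibreConductance_iff.mpr ?_
  intro v hv hbdd M hM
  obtain ⟨ρ₁, A, hρ₁, hA, N₁, h₁⟩ := hPM v hv hbdd M hM
  obtain ⟨ρ₂, B, hρ₂, hB, N₂, h₂⟩ := hCB v hv hbdd M hM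
  refine ⟨min ρ₁ ρ₂, 2 * A + 2 * B, lt_min hρ₁ hρ₂, by positivity, max N₁ N₂, ?_⟩
  intro m hm L hL hρ n hn hwin Φ hE hΦ
  have hL3 : (0 : ℝ) ≤ L ^ 3 := by positivity
  have hρ₁' : ((m + 1 : ℕ) : ℝ) ≤ ρ₁ * L ^ 3 :=
    hρ.trans (mul_le_mul_of_nonneg_right (min_le_left _ _) hL3)
  have hρ₂' : ((m + 1 : ℕ) : ℝ) ≤ ρ₂ * L ^ 3 :=
    hρ.trans (mul_le_mul_of_nonneg_right (min_le_right _ _) hL3)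
  obtain ⟨Λ, hΛm, hΛ0, hΛP, hΛA⟩ := h₁ m (le_of_max_le_left hm) L hL hρ₁' n hn hwin Φ hE hΦ
  obtain ⟨Jc, hJm, hJf, hJB⟩ := h₂ m (le_of_max_le_right hm) L hL hρ₂' n hn hwin Φ hE hΦ
  exact hLG m L hL n hn Φ hΦ Λ hΛm hΛ0 hΛP Jc hJm hJf A B hA.le hB.le hΛA hJB

/-- The crux modulo the three registered stubs (becomes a closing proof when they land). -/
theorem fibreConductance_skeleton : FibreConductance :=
  FibreConductance_of stub_localToGlobal stub_localPoincareMoment stub_coarseBeatFlow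

end Summit.AtomisticToContinuum.BoseEinsteinCondensation.Cruxes.FibreConductance.ConditionalLawPoincare

end
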